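import Literature.NumberTheory.EllipticCurves.MordellCurveThreeDescent
import Literature.NumberTheory.EllipticCurves.MordellWeil
import HarnessLib

/-!
# Dasgupta–Voight 2018, Theorem 2: for every prime `p ≡ 4, 7 (mod 9)` with `3` not a cube modulo `p`, `rank E_p(ℚ) = rank E_{p²}(ℚ) = 1` (`E_n : x³ + y³ = n`, Weierstrass model `y² = x³ − 432 n²`)

Topic `NumberTheory/EllipticCurves`. ONE named fact (`def … : Prop`, nothing asserted; D-0014):
the main theorem of Dasgupta–Voight, *Sylvester's problem and mock Heegner points*, Proc. Amer.
Math. Soc. **146** (2018), stated VERBATIM (both conclusions, `E_p` AND `E_{p²}`) on the Weierstrass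
model the paper names and the tree uses for the cube-sum curves.

## Citation header (read by this seat from the held text)

* S. Dasgupta and J. Voight, *Sylvester's problem and mock Heegner points*, Proc. Amer. Math. Soc.
  **146** (2018), no. 8, 3257–3273, doi:10.1090/proc/14008 (= arXiv:1707.05874). PUBLISHED,
  refereed journal; bib key `DasguptaVoight2018`. Held: lit store `paper:arxiv-1707.05874`
  (12 text chunks), read by this seat 2026-08-26: §1.1 (p0003 L3–L5), Theorem 2 (p0003 L39–L40),
  §1.3–1.4 (p0003 L46 – p0004 L27), §5.3 Tables (p0010 L42–L97).
* §1.1, verbatim (the curves and the model): "let `E_n` denote the projective plane curve defined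
  by the equation `x³ + y³ = n z³`. Equipped with the point `∞ = (1 : −1 : 0)`, the curve `E_n` has
  the structure of an elliptic curve over `ℚ`. (The equation for `E_n` can be transformed via a
  change of variables to yield the Weierstrass equation `y² = x³ − 432 n²`.)"
* **Theorem 2** (§1.2, p0003 L39–L40), VERBATIM: "Let `p ≡ 4, 7 (mod 9)` be prime and suppose
  that `3` is not a cube modulo `p`. Then `rank E_p(ℚ) = rank E_{p²}(ℚ) = 1`."
  (Announced with a sketch in Dasgupta–Voight, *Heegner points and Sylvester's conjecture*, Clay
  Math. Proc. 8 (2009) 91–102; "several important details were not provided and are finally given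
  here" — p0003 L44. Method: mock Heegner points on `X₀(243) → E₉` over `K = ℚ(√−3)`, descent
  through the exotic modular automorphisms of `X₀(243)`, non-torsion by reduction modulo the primes
  above `p` when `3` is not a cube mod `p` — §1.3; the upper bound `rank ≤ 1` is Satgé's
  `3`-descent, display (1).)
* The `E_p` half is ALREADY consumed in the tree through Hu–Shu–Yin 2019 Thm. 1.3 ("known":
  `HuShuYin2019/SylvesterDVFamilyProofs.lean`, `rank_analyticRank_sha_dv_family`, modulo the HSY
  fact `thm14_threePart_product`); the `E_{p²}` half — `rank E_{p²}(ℚ) = 1`, i.e. `p²` is a sum of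
  two rational cubes — had no tree statement before this file. Companions on the same model:
  `CubeSumPrimeDescentInputs.lean` (Satgé's Selmer bound and the root number for `E_p`, citing this
  paper's displays (1)–(2)), `Kriz2020/SylvesterProofs.lean`, `Yin2026/*` (Yin's CLAIMED theorems for
  ALL `p ≡ 4, 7 (mod 9)`, `d ∈ {p, p²}` — unrefereed; this file is the refereed sub-family).

## Hypotheses, enumerated (word for word → tree vocabulary)

1. "`p ≡ 4, 7 (mod 9)` prime" — `p : ℕ`, `p.Prime`, `p % 9 = 4 ∨ p % 9 = 7`.
2. "`3` is not a cube modulo `p`" — `¬ ∃ x : ZMod p, x ^ 3 = 3` (the reading already used by the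
   tree for the same hypothesis of Hu–Shu–Yin 2019 Thm. 1.3, `SylvesterDVFamilyProofs.lean`).
3. "`E_n`", `n ∈ {p, p²}` — the paper's own Weierstrass equation `y² = x³ − 432 n²`, i.e. the tree's
   `mordellCurve (-(432 * n ^ 2)) = ⟨0, 0, 0, 0, −432 n²⟩` (`MordellCurveThreeDescent`: "Cassels'
   `C_d : x³ + y³ + d z³ = 0` is `E_{−432 d²}`"; = `HuShuYin2019.cubeSumCurve n`,
   `cubeSumCurve_eq_mordellCurve`), with `n = p` and `n = p²` (`((p : ℚ) ^ 2) ^ 2 = p⁴`).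
4. "`rank E_n(ℚ)`" — `WeierstrassCurve.mordellWeilRank` (`MordellWeil.lean`), a `ℚ`-isomorphism
   invariant (tree theorem `mordellWeilRank_variableChange_holds`), so the choice of model inside the
   `ℚ`-isomorphism class `x³ + y³ = n z³ ≅ (y² = x³ − 432 n²)` is immaterial.

No `_holds` is to be expected soon (the proof is an explicit CM / modular computation on
`X₀(243)`, none of it in Mathlib). Consumer: cell `bsd-cn100`, route `MordellShaFreeCut` (rung S2b
of `BirchSwinnertonDyer`), crux `RankPosOfThreeSelmerCorankOne` restricted to the family
`D = −432 p⁴` (`Summits/…/Theorems/MordellShaFreeCutRungDVSquare.lean`).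

## References
* [DasguptaVoight2018] S. Dasgupta, J. Voight, *Sylvester's problem and mock Heegner points*,
  Proc. Amer. Math. Soc. 146 (2018) 3257–3273, Thm. 2 (§1.2), §1.1, §1.3–1.4, §5.3.
* P. Satgé, *Groupes de Selmer et corps cubiques*, J. Number Theory 23 (1986) 294–317 (the
  `3`-descent bound, display (1) of the paper; tree `CubeSumPrimeDescentInputs.lean`).
* Y. Hu, J. Shu, H. Yin, *An explicit Gross–Zagier formula related to the Sylvester conjecture*,
  Trans. Amer. Math. Soc. 372 (2019) 6905–6925, Thm. 1.2–1.3 (the `E_p` half as "known").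
-/

open WeierstrassCurve

namespace Literature.NumberTheory.EllipticCurves.DasguptaVoight2018

/-- **Dasgupta–Voight, Proc. AMS 146 (2018), Theorem 2** (verbatim): "Let `p ≡ 4, 7 (mod 9)` be
prime and suppose that `3` is not a cube modulo `p`. Then `rank E_p(ℚ) = rank E_{p²}(ℚ) = 1`."
Here `E_n : x³ + y³ = n z³` on the paper's Weierstrass model `y² = x³ − 432 n²` (§1.1), i.e. the
tree's `mordellCurve (-(432 * n ^ 2))`, with `n = p` (first conjunct) and `n = p²` (second
conjunct; `−432 (p²)² = −432 p⁴`); "`3` is not a cube modulo `p`" as `¬ ∃ x : ZMod p, x³ = 3`.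
[cite: DasguptaVoight2018, Thm. 2 (§1.2; arXiv:1707.05874 p. 3) and §1.1 (the model y² = x³ − 432n²)] -/
def thm2_mordellWeilRank_eq_one_cubeSum_prime_and_sq : Prop :=
  ∀ ⦃p : ℕ⦄, p.Prime → (p % 9 = 4 ∨ p % 9 = 7) → (¬ ∃ x : ZMod p, x ^ 3 = 3) →
    (mordellCurve (-(432 * (p : ℚ) ^ 2))).mordellWeilRank = 1 ∧
      (mordellCurve (-(432 * ((p : ℚ) ^ 2) ^ 2))).mordellWeilRank = 1

end Literature.NumberTheory.EllipticCurves.DasguptaVoight2018
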